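import Summits.HodgeConjecture.HodgeConjecture.Theorems.CyclicUnitaryPowersLocalMonodromyReflection
import Summits.HodgeConjecture.HodgeConjecture.Theorems.CyclicUnitaryPowersFiveFactsPrime
import Literature.AlgebraicGeometry.HodgeTheory.CyclicReflectionSystemOfMeridianPowers
import HarnessLib

/-!
# Crux K1-A, the `σ`-FREE LOCAL MONODROMY re-cut (II): the Picard–Lefschetz package, `VeryGeneralDeckCommutatorsInHg`
# and the rung leaf from `carlsonToledo1999_nodalMeridianLocalMonodromy` (route `CyclicUnitaryPowers`, item stmt-HodgeConjecture-19544)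

Prover seat `hodge-nonav-prover-Ax` (g9), cell `hodge-nonav`. Landed `--supports stmt-HodgeConjecture-19544`; sorry-free,
no definition, no new named fact here. CONDITIONAL results; nothing here says HC ∕ HC_AV is proved; rung F-H1 is not moved.
Sequel of `CyclicUnitaryPowersLocalMonodromyReflection` (per-meridian recognition):

* §3 `exists_cyclicReflectionSystem_of_localMonodromy` — **local-monodromy fact → PL package at every prime `p ≥ 3`**
  (`nonempty_cyclicReflectionSystem_of_meridian_powers` with the meridians centred at the explicit one-nodal form,
  Zariski–van Kampen, meridian conjugacy, the proved invariant-cycle theorem);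
  `nonempty_carlsonToledoFamily_of_localMonodromy` — the Carlson–Toledo structure at primes;
* §4 **`veryGeneralDeckCommutatorsInHg_of_localMonodromy_facts (H1 : carlsonToledo1999_nodalMeridianLocalMonodromy)
  (hCT2) (hCDK) : VeryGeneralDeckCommutatorsInHg`** and the leaf `cyclicSurfacePowersHodge_of_localMonodromy_facts` —
  K1-A ⟸ {local monodromy of `A_{p−1}` (CT99 §6 without the deck identification), CT2 eigen-Hodge numbers, CDK}.

## References

* [CarlsonToledo1999] J. A. Carlson, D. Toledo, Duke Math. J. 97 (1999), §1, §2, §3, §6 (kdoublept) and Proposition, §7.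
* [Shimada2010ZvK] I. Shimada, arXiv:0906.1074, §3 Prop. 3.4.
* [VoisinHodgeII2003] C. Voisin, Hodge Theory and Complex Algebraic Geometry II, §3.1.2, §6.2.1.
* [CattaniDeligneKaplan1995] E. Cattani, P. Deligne, A. Kaplan, J. Amer. Math. Soc. 8 (1995), Thm. 1.1, Cor. 1.2.
-/

noncomputable section

set_option linter.dupNamespace false

open CategoryTheory MvPolynomial _root_.Topology
open Literature.AlgebraicTopology.SingularHomology
open Literature.AlgebraicGeometry.Motives Literature.AlgebraicGeometry.Motives.UniversalHypersurface
open Literature.AlgebraicGeometry.HodgeTheory Literature.AlgebraicGeometry.HodgeTheory.UniversalHypersurface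
open Literature.AlgebraicGeometry.FundamentalGroup
open Summit.HodgeConjecture.HodgeConjecture.Theorems.SignSymmetricPowersMeridianMonodromy
open Summit.HodgeConjecture.HodgeConjecture.Theorems.CyclicUnitaryPowersPLPackageOfMeridians
open Summit.HodgeConjecture.HodgeConjecture.Theorems.CyclicUnitaryPowersNodalMeridianExists
open Summit.HodgeConjecture.HodgeConjecture.Theorems.CyclicUnitaryPowersMonodromyIsometry
open Summit.HodgeConjecture.HodgeConjecture.Theorems.CyclicUnitaryPowersDeckModelClauses

open Summit.HodgeConjecture.HodgeConjecture.Theorems.CyclicUnitaryPowersLocalMonodromyReflection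

namespace Summit.HodgeConjecture.HodgeConjecture.Theorems.CyclicUnitaryPowersPLPackageOfLocalMonodromy

/-! ### §3 The package and the Carlson–Toledo structure at primes from the local-monodromy fact -/

section Assembly

variable {p : ℕ} [NeZero p]

/-- **Local-monodromy fact → Picard–Lefschetz package at a prime `p ≥ 3`.** As in
`CyclicUnitaryPowersPLPackageOfNodalMeridian.carlsonToledo1999_cyclicReflectionSystem_of_nodalMeridian_facts`: the
generating set `𝓜` is the set of transports of the meridians centred at the explicit one-nodal ternary `p`-form
(`exists_meridian_center_uninodal`); they generate `Γ` (`closure_meridian_loopClasses_center_eq_top`, Zariski–van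
Kampen), are pairwise conjugate (`affineHypersurfaceComplement_meridian_isConj_holds`), and for each of them the
local-monodromy fact and §2 supply a power which is the cyclic reflection; `nonempty_cyclicReflectionSystem_of_meridian_powers`
assembles, the invariant-cycle clause being the tree theorem `carlsonToledo1999_monodromyInvariants_eq_deckInvariants_holds`.
CONDITIONAL on the one cited fact. [cite: CarlsonToledo1999, §2, §3, §6 (kdoublept) and Proposition, §7 last paragraph]
[cite: Shimada2010ZvK, §3 Prop. 3.4] -/
theorem exists_cyclicReflectionSystem_of_localMonodromy (H1 : carlsonToledo1999_nodalMeridianLocalMonodromy)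
    (hp : p.Prime) (h3 : 3 ≤ p) {f : MvPolynomial (Fin 3) ℂ} (hf : f.IsHomogeneous p) (hf0 : f ≠ 0)
    (hX : IsSmoothProjective 2 (SmoothHypersurface.hypersurface (cyclicCoverForm p f))) :
    ∃ (e : fiberOver (cyclicCoverFamily p) (cyclicCoverPoint p f) ≅
          SmoothHypersurface.hypersurface (cyclicCoverForm p f))
      (τ : bettiCohomology (fiberOver (cyclicCoverFamily p) (cyclicCoverPoint p f)) 2 ≃ₗ[ℚ]
        bettiCohomology (fiberOver (cyclicCoverFamily p) (cyclicCoverPoint p f)) 2),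
      (∀ (ha : deckUnit p ∈ diagonalStabilizer (cyclicCoverForm p f))
          (x : bettiCohomology (fiberOver (cyclicCoverFamily p) (cyclicCoverPoint p f)) 2),
          BettiUniverse.pullEquiv e 2 (τ x) =
            BettiUniverse.pull (diagonalAut (cyclicCoverForm p f) ha) 2 (BettiUniverse.pullEquiv e 2 x)) ∧
      Nonempty (CyclicReflectionSystem
        (ratMonodromyGroup (cyclicCoverFamily p) 2 (cyclicCoverFamily_locallyTrivial p)
          ⟨cyclicCoverPoint p f, Set.mem_univ _⟩)
        (transportedTraceForm hX e 2) τ p) := by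
  have hodd : Odd p := hp.odd_of_ne_two (by omega)
  have hp2 : 2 ≤ p := by omega
  have hp0 : p ≠ 0 := by omega
  have hJ := CyclicCoverFormNonsingular.isNonsingularForm_cyclicCoverForm_of_isSmoothProjective hp2 hf hf0 hX
  -- the identification and the covering automorphism
  obtain ⟨e, he⟩ := exists_isCompatibleFibreIso p hf hJ
  obtain ⟨τ, hτ⟩ := exists_deck_intertwining e
  refine ⟨e, τ, hτ, ?_⟩
  have hBs : (transportedTraceForm hX e 2).IsSymm := transportedTraceForm_isSymm hX e (by decide)
  have hBnd : (transportedTraceForm hX e 2).Nondegenerate := transportedTraceForm_nondegenerate hX e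
  have hBτ : ∀ x y, transportedTraceForm hX e 2 (τ x) (τ y) = transportedTraceForm hX e 2 x y :=
    transportedTraceForm_deck hX e hτ
  -- the coefficient chart of the base and an irreducible equation of the discriminant
  obtain ⟨D, hDirr, hDeq⟩ := exists_irreducible_discriminantEquation p hp2
  obtain ⟨χ, hχ⟩ := exists_homeomorph_affineHypersurfaceComplement p hDeq
  have hDeq' : IsDiscriminantEquation p D := hDeq
  have hχ' : IsCoefficientChart p D χ := hχ
  have hirr : ∀ j : Fin 1, Irreducible ((![D] : Fin 1 → MvPolynomial (TernaryIndex p) ℂ) j) := fun j => by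
    fin_cases j; exact hDirr
  -- base points and the pointed homeomorphism `Set.univ ≃ₜ {D ≠ 0}`
  let s₀ : ComplexPoints (cyclicCoverBase p) := cyclicCoverPoint p f
  let u₀ : (Set.univ : Set (ComplexPoints (cyclicCoverBase p))) := ⟨s₀, Set.mem_univ _⟩
  let Ψ : (Set.univ : Set (ComplexPoints (cyclicCoverBase p))) ≃ₜ affineHypersurfaceComplement ![D] :=
    (Homeomorph.Set.univ _).trans χ
  have hΨ : Ψ.symm (χ s₀) = u₀ := by
    rw [Homeomorph.symm_apply_eq]
    rfl
  let φ := FundamentalGroup.mapOfEq (Ψ.symm : C(affineHypersurfaceComplement ![D],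
    (Set.univ : Set (ComplexPoints (cyclicCoverBase p))))) hΨ
  have hφsurj : Function.Surjective φ := mapOfEq_surjective_of_homeomorph Ψ.symm hΨ
  -- the monodromy representation on `π₁(Set.univ, u₀)`
  obtain ⟨ρ, hρ, hrange⟩ := exists_monodromyHom (cyclicCoverFamily p) 2 (cyclicCoverFamily_locallyTrivial p)
    (isRationalClass_transportFun_cyclicCoverFamily) u₀
  -- ONE meridian centred at a one-nodal branch curve (the degeneration (kdoublept), CHOSEN)
  obtain ⟨μ₀, x₀, hnod₀⟩ := exists_meridian_center_uninodal h3 hDirr hDeq' (χ s₀)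
  -- reading a meridian loop back in `S(ℂ)`
  have hread : ∀ μ : Meridian ![D] (χ s₀) 0, ∃ γ : Path s₀ s₀, (∀ θ, χ (γ θ) = μ.loop θ) ∧
      FundamentalGroup.toPath (φ μ.loopClass) = cyclicCoverLoopClass p γ := by
    intro μ
    have hx : s₀ = χ.symm (χ s₀) := (χ.symm_apply_apply s₀).symm
    refine ⟨(μ.loop.map χ.symm.continuous).cast hx hx, fun θ => ?_, ?_⟩
    · change χ (χ.symm (μ.loop θ)) = μ.loop θ
      exact χ.apply_symm_apply _
    · dsimp only [φ]
      erw [Meridian.loopClass_def, mapOfEq_fromPath_mk]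
      change Path.Homotopic.Quotient.mk _ = Path.Homotopic.Quotient.mk _
      congr 1
  -- the transports of the meridians centred at `μ₀.y`: a power is the cyclic reflection (H1 and §2)
  have hmer : ∀ μ : Meridian ![D] (χ s₀) 0, μ.y = μ₀.y →
      ∃ (r : bettiCohomology (fiberOver (cyclicCoverFamily p) (cyclicCoverPoint p f)) 2 ≃ₗ[ℚ]
          bettiCohomology (fiberOver (cyclicCoverFamily p) (cyclicCoverPoint p f)) 2)
        (δ : bettiCohomology (fiberOver (cyclicCoverFamily p) (cyclicCoverPoint p f)) 2),
        r ∈ ratMonodromyGroup (cyclicCoverFamily p) 2 (cyclicCoverFamily_locallyTrivial p) u₀ ∧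
        ρ (φ μ.loopClass) ∈ Subgroup.zpowers r ∧
        δ ≠ 0 ∧ (∑ i ∈ Finset.range p, (τ ^ i) δ) = 0 ∧ Module.finrank ℚ (cyclicSpan τ δ) = p - 1 ∧
        (∀ x ∈ cyclicSpan τ δ, (∀ y ∈ cyclicSpan τ δ, transportedTraceForm hX e 2 x y = 0) → x = 0) ∧
        IsCyclicReflection (transportedTraceForm hX e 2) τ δ r ∧
        LinearMap.range ((ρ (φ μ.loopClass) : _ →ₗ[ℚ] _) - LinearMap.id) = cyclicSpan τ δ := by
    intro μ hμy
    obtain ⟨γ, hγ, hcls⟩ := hread μ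
    have hμ : ∃ x : Fin 3 → ℂ, IsNodalFormWithNodes (n := 1)
        (∑ e : TernaryIndex p, MvPolynomial.monomial e.1 (μ.y e)) ![x] := ⟨x₀, by rw [hμy]; exact hnod₀⟩
    obtain ⟨T, W, hT, hrangeW, hsumW, hdimW⟩ := H1 hodd h3 f hf hf0 hX D hDirr hDeq' χ hχ' μ hμ γ hγ
    have hTρ : ρ (φ μ.loopClass) = T := by
      refine isRatTransport_unique (cyclicCoverFamily p) 2 (cyclicCoverFamily_locallyTrivial p) (hρ _) ?_
      rw [hcls]
      exact hT
    rw [hTρ]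
    exact exists_reflection_power_of_localMonodromy hp h3 hf hf0 hX e he τ hτ hT hrangeW hsumW hdimW
  -- the set of meridian transports
  let 𝓜 : Set (bettiCohomology (fiberOver (cyclicCoverFamily p) (cyclicCoverPoint p f)) 2 ≃ₗ[ℚ]
      bettiCohomology (fiberOver (cyclicCoverFamily p) (cyclicCoverPoint p f)) 2) :=
    {g | ∃ μ : Meridian ![D] (χ s₀) 0, μ.y = μ₀.y ∧ g = ρ (φ μ.loopClass)}
  have hρmem : ∀ c, ρ c ∈ ratMonodromyGroup (cyclicCoverFamily p) 2 (cyclicCoverFamily_locallyTrivial p) u₀ :=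
    fun c => hrange ▸ ⟨c, rfl⟩
  haveI : Module.Finite ℚ (bettiCohomology (fiberOver (cyclicCoverFamily p) (cyclicCoverPoint p f)) 2) :=
    BettiUniverse.finite ((isSmoothProjectiveFamily_cyclicCoverFamily p).isSmoothProjective (cyclicCoverPoint p f)) 2
  refine nonempty_cyclicReflectionSystem_of_meridian_powers hBs hBnd hBτ hp0 (𝓜 := 𝓜) ?_ ?_ ?_ ?_
  · -- `Γ ≤ closure 𝓜`: Zariski–van Kampen from `μ₀` through `φ` and `ρ` (conjugates keep the centre)
    have hclos := closure_meridian_loopClasses_center_eq_top hDirr μ₀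
    have hclos' : Subgroup.closure (φ '' {c | ∃ μ : Meridian ![D] (χ s₀) 0, μ.y = μ₀.y ∧ c = μ.loopClass}) = ⊤ := by
      rw [← MonoidHom.map_closure, hclos, ← MonoidHom.range_eq_map, MonoidHom.range_eq_top.mpr hφsurj]
    intro g hg
    rw [← hrange] at hg
    obtain ⟨c, rfl⟩ := hg
    have hc : c ∈ Subgroup.closure (φ '' {c | ∃ μ : Meridian ![D] (χ s₀) 0, μ.y = μ₀.y ∧ c = μ.loopClass}) := by
      rw [hclos']; exact Subgroup.mem_top c
    have hmap : ρ c ∈ (Subgroup.closure (φ '' {c | ∃ μ : Meridian ![D] (χ s₀) 0,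
        μ.y = μ₀.y ∧ c = μ.loopClass})).map ρ :=
      Subgroup.mem_map_of_mem ρ hc
    rw [MonoidHom.map_closure] at hmap
    refine (Subgroup.closure_le _).mpr ?_ hmap
    rintro _ ⟨_, ⟨_, ⟨μ, hμy, rfl⟩, rfl⟩, rfl⟩
    exact Subgroup.subset_closure ⟨μ, hμy, rfl⟩
  · -- any two meridian transports are conjugate (meridian conjugacy)
    rintro T ⟨μ₁, -, rfl⟩ T' ⟨μ₂, -, rfl⟩
    have hconj := affineHypersurfaceComplement_meridian_isConj_holds (TernaryIndex p) 1 ![D] hirr (χ s₀) 0 μ₁ μ₂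
    obtain ⟨c, hc⟩ := isConj_iff.mp hconj
    refine ⟨ρ (φ c), hρmem _, ?_⟩
    rw [← hc, map_mul, map_mul, map_inv, map_mul, map_mul, map_inv]
  · -- the local Picard–Lefschetz content (H1 + recognition)
    rintro T ⟨μ, hμy, rfl⟩
    exact hmer μ hμy
  · -- monodromy invariants are `τ`-invariant (tree theorem)
    exact fun x hx => carlsonToledo1999_monodromyInvariants_eq_deckInvariants_holds hodd h3 f hf hf0 hX e he τ hτ x hx

/-- **The Carlson–Toledo structure at every prime `p ≥ 3` from the local-monodromy fact** (the construction half is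
the tree's `cyclicCoverFamily`, as in `carlsonToledoFamilyOfSystem`). CONDITIONAL on the one cited fact.
[cite: CarlsonToledo1999, §2, §3, §6 (kdoublept) and Proposition, §7 last paragraph] -/
theorem nonempty_carlsonToledoFamily_of_localMonodromy (H1 : carlsonToledo1999_nodalMeridianLocalMonodromy)
    (hp : p.Prime) (h3 : 3 ≤ p) : Nonempty (CarlsonToledoFamily p) := by
  have hp2 : 2 ≤ p := by omega
  have h := fun (f : MvPolynomial (Fin 3) ℂ) (hf : f.IsHomogeneous p) (hf0 : f ≠ 0)
    (hX : IsSmoothProjective 2 (SmoothHypersurface.hypersurface (cyclicCoverForm p f))) =>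
    exists_cyclicReflectionSystem_of_localMonodromy H1 hp h3 hf hf0 hX
  exact ⟨{
    Y := cyclicCoverTotal p
    S := cyclicCoverBase p
    u := cyclicCoverFamily p
    isSmoothProjectiveFamily := isSmoothProjectiveFamily_cyclicCoverFamily p
    isQuasiProjectiveOver := isQuasiProjectiveOver_baseSpz 2 p (cyclicCoverSpz p)
    isQuasiProjectiveOver_total :=
      isQuasiProjectiveOver_totalSpz 2 p (cyclicCoverSpz p) (cyclicCoverSpz_surjective p (NeZero.ne p))
    smooth := smooth_baseSpz_hom ℂ 2 p (cyclicCoverSpz p)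
    irreducibleSpace := irreducibleSpace_cyclicCoverBase p
    locallyTrivial := cyclicCoverFamily_locallyTrivial p
    pt := cyclicCoverPoint p
    exists_polynomials := cyclicCoverPoint_exists_polynomials p hp2
    pt_surjective := cyclicCoverPoint_surjective p hp2
    iso := fun f hf hf0 hX => (h f hf hf0 hX).choose
    deck := fun f hf hf0 hX => (h f hf hf0 hX).choose_spec.choose
    pullEquiv_deck := fun f hf hf0 hX ha x => (h f hf hf0 hX).choose_spec.choose_spec.1 ha x
    system := fun f hf hf0 hX => ((h f hf hf0 hX).choose_spec.choose_spec.2).some }⟩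

end Assembly

/-! ### §4 Crux K1 and the rung leaf from the local-monodromy fact -/

section Crux

/-- **Crux K1 `VeryGeneralDeckCommutatorsInHg` modulo THREE cited facts, the Picard–Lefschetz input being the
`σ`-FREE local monodromy of the `A_{p−1}` degeneration**: `carlsonToledo1999_nodalMeridianLocalMonodromy` (CT99 §6 at
(kdoublept) without the deck identification — Milnor/Brieskorn local monodromy), the eigen-Hodge numbers CT2 (CT99 §5)
and the CDK cover. The deck identification, the commutation of monodromy and covering group, the invariant line, the
invariant cycles and the density theorem are tree theorems. CONDITIONAL; nothing here says HC ∕ HC_AV is proved.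
[cite: CarlsonToledo1999, §5, §6 (kdoublept)] [cite: CattaniDeligneKaplan1995, Thm. 1.1 and Cor. 1.2] -/
theorem veryGeneralDeckCommutatorsInHg_of_localMonodromy_facts
    (H1 : carlsonToledo1999_nodalMeridianLocalMonodromy)
    (hCT2 : carlsonToledo1999_finrank_eigenspace_inf_hodgePiece)
    (hCDK : cmsp_nonHodgeGenericPoints_countable_algebraic_cover) :
    Summit.HodgeConjecture.HodgeConjecture.Theses.CyclicUnitaryPowers.VeryGeneralDeckCommutatorsInHg :=
  CyclicUnitaryPowersFiveFactsPrime.veryGeneralDeckCommutatorsInHg_of_prime_family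
    (fun _ hp h7 => haveI : NeZero _ := ⟨hp.ne_zero⟩
      nonempty_carlsonToledoFamily_of_localMonodromy H1 hp (by omega)) @hCT2 @hCDK

/-- **The rung-F-H1 leaf `CyclicSurfacePowersHodge` modulo the same three facts.** CONDITIONAL; rung F-H1 not moved.
[cite: CarlsonToledo1999, §5, §6 (kdoublept)] [cite: CattaniDeligneKaplan1995, Thm. 1.1 and Cor. 1.2] -/
theorem cyclicSurfacePowersHodge_of_localMonodromy_facts
    (H1 : carlsonToledo1999_nodalMeridianLocalMonodromy)
    (hCT2 : carlsonToledo1999_finrank_eigenspace_inf_hodgePiece)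
    (hCDK : cmsp_nonHodgeGenericPoints_countable_algebraic_cover) :
    Summit.HodgeConjecture.HodgeConjecture.Theses.CyclicUnitaryPowers.CyclicSurfacePowersHodge :=
  CyclicUnitaryPowersFiveFactsPrime.cyclicSurfacePowersHodge_of_prime_family
    (fun _ hp h7 => haveI : NeZero _ := ⟨hp.ne_zero⟩
      nonempty_carlsonToledoFamily_of_localMonodromy H1 hp (by omega)) @hCT2 @hCDK

end Crux

end Summit.HodgeConjecture.HodgeConjecture.Theorems.CyclicUnitaryPowersPLPackageOfLocalMonodromy

end
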